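import Summits.KontsevichZagierPeriods.KontsevichZagierPeriods.Theorems.PlanarK0Injective.Negative.Kit
import Summits.KontsevichZagierPeriods.KontsevichZagierPeriods.Theorems.PlanarCompiler.Negative.GreenTightness

/-!
# `PlanarCompiler` (stmt-KontsevichZagierPeriods-10058) — negative side V: THE FOLD IS REAL

The route's plan compiles a Green instance `(A, B, S)` by the equal-Jacobian transport
`Ψ₂ ∘ Ψ₁⁻¹`, `Ψ₁ = (a, A)`, `Ψ₂ = (b, B)`, "after subdividing Δ by the sign of ∂_bA = ∂_aB".
THEOREM `not_naiveGreenBands`: the subdivision is necessary. For the POLYNOMIAL potential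
`S = (a² − a)·b` (`A = (2a−1)b`, `B = a² − a`, twist `S_ab = 2a − 1` changing sign on `a = ½`) the
band swept by the vertical traces, `Ω₁ = {a ∈ (0,1), y between A(a,0) and A(a,1−a)}`, has area
`∫₀¹ |2a−1|(1−a) da = 1/4` (`volume_bandOne`) while the band swept by the horizontal traces,
`Ω₂ = {b ∈ (0,1), w between B(0,b) and B(1−b,b)}`, has area `∫₀¹ (b − b²) db = 1/6`
(`volume_bandTwo`); so the two bands are not even KZ-equivalent (soundness
`KZ.Equivalent.value_eq_holds`), although the SIGNED identity behind the Green generator holds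
(`fold_signed_identity`: `∫₀¹ (2a−1)(1−a) da = −1/6 = ∫₀¹ (b² − b) db`). The folded sheet over
`a < ½` must be counted negatively: every realisation of the Green generator as planar moves must
see the sign of the twist (sign subdivision, a twist-restoring shear, or signed multiplicities).
Builds on the sibling crux's kit `Theorems/PlanarK0Injective/Negative/Kit.lean` and on
`Negative/GreenTightness.lean` (the closed triangle).
[Kontsevich–Zagier 2001, §1.2; Arnold 1989, §47A]
-/

noncomputable section

open MeasureTheory Set MvPolynomial
open Literature.NumberTheory.Transcendental Literature.ModelTheory.ExponentialFields

namespace Summit.KontsevichZagierPeriods.SymplecticScissors.PlanarCompilerNegative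

open Summit.KontsevichZagierPeriods.SymplecticScissors.PlanarK0InjectiveNegative (isSemialgebraicFunOn_one)

/-- The value of an integrand-1 representation is the area of its domain. [folklore] -/
theorem value_of_integrand_one (r : KZ.IntegralRep 2) (hr : r.integrand = fun _ => 1) :
    r.value = (volume r.domain).toReal := by
  rw [KZ.IntegralRep.value, hr, setIntegral_const, smul_eq_mul, mul_one, measureReal_def]

/-! ## §5 THE FOLD IS REAL: the unsubdivided band reading of the Green step is FALSE

The route's plan compiles a Green instance `(A, B, S)` by the equal-Jacobian transport
`Ψ₂ ∘ Ψ₁⁻¹`, `Ψ₁ = (a, A)`, `Ψ₂ = (b, B)`, "after subdividing Δ by the sign of ∂_bA = ∂_aB". The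
subdivision (equivalently: the twist-restoring shear, or signed multiplicities) is NOT cosmetic. The
naive reading — "the band swept by the vertical traces, `Ω₁ = {a ∈ (0,1), y between A(a,0) and
A(a,1−a)}`, and the band swept by the horizontal traces, `Ω₂ = {b ∈ (0,1), w between B(0,b) and
B(1−b,b)}`, are equivalent planar sets" — is false already for the POLYNOMIAL potential
`S = (a² − a)·b` (`A = (2a−1)b`, `B = a² − a`, twist `S_ab = 2a − 1` changing sign on `a = ½`):
`area Ω₁ = ∫₀¹ |2a−1|(1−a) da = 1/4` but `area Ω₂ = ∫₀¹ (b − b²) db = 1/6`. Hence `Ω₁, Ω₂` are not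
even KZ-equivalent (`not_naiveGreenBands`, soundness), let alone one rule-2 instance or a planar
chain. Signed, the identity holds (`∫₀¹ (2a−1)(1−a) da = −1/6`): the fold over `a < ½` is counted
with the wrong sign by the unsigned band. Any line must see the sign of the twist. -/

/-- The fold datum: `A = (2a − 1)·b`. [folklore] -/
def foldA : (Fin 2 → ℝ) → ℝ := fun p => (2 * p 0 - 1) * p 1
/-- The fold datum: `B = a² − a`. [folklore] -/
def foldB : (Fin 2 → ℝ) → ℝ := fun p => p 0 ^ 2 - p 0
/-- The fold datum: `S = (a² − a)·b`, a polynomial potential with `dS = A da + B db` everywhere. [folklore] -/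
def foldS : (Fin 2 → ℝ) → ℝ := fun p => (p 0 ^ 2 - p 0) * p 1

/-- Auxiliary: `isSemialgebraicFunOn_foldA`. [folklore] -/
theorem isSemialgebraicFunOn_foldA : IsSemialgebraicFunOn ℚ triangle foldA := by
  refine (isSemialgebraicFunOn_aeval isSemialgebraic_triangle ((C 2 * X 0 - C 1) * X 1)).congr ?_
  intro p _; simp [foldA]

/-- Auxiliary: `isSemialgebraicFunOn_foldB`. [folklore] -/
theorem isSemialgebraicFunOn_foldB : IsSemialgebraicFunOn ℚ triangle foldB := by
  refine (isSemialgebraicFunOn_aeval isSemialgebraic_triangle (X 0 ^ 2 - X 0)).congr ?_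
  intro p _; simp [foldB]

/-- Auxiliary: `continuous_foldA`. [folklore] -/
theorem continuous_foldA : Continuous foldA := by unfold foldA; fun_prop
/-- Auxiliary: `continuous_foldB`. [folklore] -/
theorem continuous_foldB : Continuous foldB := by unfold foldB; fun_prop

/-- `dS = A da + B db` (everywhere). [folklore] -/
theorem hasFDerivAt_foldS (p : Fin 2 → ℝ) :
    HasFDerivAt foldS (foldA p • ContinuousLinearMap.proj (R := ℝ) (φ := fun _ : Fin 2 => ℝ) 0 +
      foldB p • ContinuousLinearMap.proj (R := ℝ) (φ := fun _ : Fin 2 => ℝ) 1) p := by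
  have h0 : HasFDerivAt (fun q : Fin 2 → ℝ => q 0) (ContinuousLinearMap.proj (R := ℝ)
      (φ := fun _ : Fin 2 => ℝ) 0) p := hasFDerivAt_apply 0 p
  have h1 : HasFDerivAt (fun q : Fin 2 → ℝ => q 1) (ContinuousLinearMap.proj (R := ℝ)
      (φ := fun _ : Fin 2 => ℝ) 1) p := hasFDerivAt_apply 1 p
  have hq := (h0.pow 2).sub h0
  have h := hq.mul h1
  refine h.congr_fderiv ?_
  ext v
  simp [foldA, foldB]
  ring

/-- The vertical-trace band `Ω₁` of the fold datum ("between" made orientation-free). [folklore] -/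
def bandOne : Set (Fin 2 → ℝ) :=
  {q | q 0 ∈ Ioo (0 : ℝ) 1 ∧ ((foldA ![q 0, 0] < q 1 ∧ q 1 < foldA ![q 0, 1 - q 0]) ∨
    (foldA ![q 0, 1 - q 0] < q 1 ∧ q 1 < foldA ![q 0, 0]))}

/-- The horizontal-trace band `Ω₂` of the fold datum. [folklore] -/
def bandTwo : Set (Fin 2 → ℝ) :=
  {q | q 0 ∈ Ioo (0 : ℝ) 1 ∧ ((foldB ![0, q 0] < q 1 ∧ q 1 < foldB ![1 - q 0, q 0]) ∨
    (foldB ![1 - q 0, q 0] < q 1 ∧ q 1 < foldB ![0, q 0]))}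

/-- The fold profile `h(a) = A(a, 1−a) = (2a−1)(1−a)`. [folklore] -/
def foldH : ℝ → ℝ := fun a => (2 * a - 1) * (1 - a)

/-- Auxiliary: `foldA_bottom`. [folklore] -/
@[simp] theorem foldA_bottom (a : ℝ) : foldA ![a, 0] = 0 := by simp [foldA]
/-- Auxiliary: `foldA_top`. [folklore] -/
@[simp] theorem foldA_top (a : ℝ) : foldA ![a, 1 - a] = foldH a := by simp [foldA, foldH]
/-- Auxiliary: `foldB_left`. [folklore] -/
@[simp] theorem foldB_left (b : ℝ) : foldB ![0, b] = 0 := by simp [foldB]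
/-- Auxiliary: `foldB_right`. [folklore] -/
@[simp] theorem foldB_right (b : ℝ) : foldB ![1 - b, b] = b ^ 2 - b := by simp [foldB]; ring

/-- Transport of a fibred planar set to `ℝ × ℝ`: preimage of `regionBetween` under `finTwoArrow`. [folklore] -/
theorem preimage_regionBetween (f g : ℝ → ℝ) (s : Set ℝ) :
    (MeasurableEquiv.finTwoArrow : (Fin 2 → ℝ) ≃ᵐ ℝ × ℝ) ⁻¹' regionBetween f g s =
      {q : Fin 2 → ℝ | q 0 ∈ s ∧ f (q 0) < q 1 ∧ q 1 < g (q 0)} := by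
  ext q
  simp [regionBetween, MeasurableEquiv.finTwoArrow_apply]

/-- Area of a fibred planar set `{a ∈ (u,v), f a < y < g a}` with `f ≤ g` continuous. [folklore] -/
theorem volume_fibred {f g : ℝ → ℝ} {u v : ℝ} (hf : Continuous f) (hg : Continuous g)
    (hfg : ∀ x ∈ Ioo u v, f x ≤ g x) :
    volume {q : Fin 2 → ℝ | q 0 ∈ Ioo u v ∧ f (q 0) < q 1 ∧ q 1 < g (q 0)} =
      ENNReal.ofReal (∫ x in Ioo u v, (g x - f x)) := by
  rw [← preimage_regionBetween,
    (volume_preserving_finTwoArrow ℝ).measure_preimage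
      (measurableSet_regionBetween hf.measurable hg.measurable measurableSet_Ioo).nullMeasurableSet,
    Measure.volume_eq_prod,
    volume_regionBetween_eq_integral (hf.integrableOn_Icc.mono_set Ioo_subset_Icc_self)
      (hg.integrableOn_Icc.mono_set Ioo_subset_Icc_self) measurableSet_Ioo hfg]
  rfl

/-- Auxiliary: `setIntegral_Ioo_eq_intervalIntegral`. [folklore] -/
theorem setIntegral_Ioo_eq_intervalIntegral {f : ℝ → ℝ} {u v : ℝ} (huv : u ≤ v) :
    ∫ x in Ioo u v, f x = ∫ x in u..v, f x := by
  rw [intervalIntegral.integral_of_le huv, integral_Ioc_eq_integral_Ioo]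

/-- `∫₀¹ (0 − (b² − b)) db = 1/6`. [folklore] -/
theorem integral_bandTwo : ∫ x in (0 : ℝ)..1, ((0 : ℝ) - (x ^ 2 - x)) = 1 / 6 := by
  have h : ∀ x ∈ uIcc (0 : ℝ) 1,
      HasDerivAt (fun x : ℝ => x ^ 2 / 2 - x ^ 3 / 3) ((0 : ℝ) - (x ^ 2 - x)) x := by
    intro x _
    have := ((hasDerivAt_pow 2 x).div_const 2).sub ((hasDerivAt_pow 3 x).div_const 3)
    refine this.congr_deriv ?_
    simp only [Nat.reduceSub, pow_one, Nat.cast_ofNat]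
    ring
  rw [intervalIntegral.integral_eq_sub_of_hasDerivAt h ((by fun_prop : Continuous fun x : ℝ =>
    (0 : ℝ) - (x ^ 2 - x)).intervalIntegrable _ _)]
  norm_num

/-- `∫_{½}^1 (2a−1)(1−a) da = 1/24` (the positive sheet). [folklore] -/
theorem integral_bandOne_pos : ∫ x in (1 / 2 : ℝ)..1, (foldH x - 0) = 1 / 24 := by
  have h : ∀ x ∈ uIcc (1 / 2 : ℝ) 1,
      HasDerivAt (fun x : ℝ => -(2 / 3) * x ^ 3 + (3 / 2) * x ^ 2 - x) (foldH x - 0) x := by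
    intro x _
    have := ((((hasDerivAt_pow 3 x).const_mul (-(2 / 3) : ℝ)).add
      ((hasDerivAt_pow 2 x).const_mul (3 / 2 : ℝ))).sub (hasDerivAt_id x))
    refine this.congr_deriv ?_
    simp only [Nat.reduceSub, pow_one, Nat.cast_ofNat, foldH]
    ring
  rw [intervalIntegral.integral_eq_sub_of_hasDerivAt h ((by unfold foldH; fun_prop : Continuous fun x : ℝ =>
    foldH x - 0).intervalIntegrable _ _)]
  norm_num

/-- `∫₀^{½} (0 − (2a−1)(1−a)) da = 5/24` (the folded sheet). [folklore] -/
theorem integral_bandOne_neg : ∫ x in (0 : ℝ)..(1 / 2), ((0 : ℝ) - foldH x) = 5 / 24 := by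
  have h : ∀ x ∈ uIcc (0 : ℝ) (1 / 2),
      HasDerivAt (fun x : ℝ => (2 / 3) * x ^ 3 - (3 / 2) * x ^ 2 + x) ((0 : ℝ) - foldH x) x := by
    intro x _
    have := ((((hasDerivAt_pow 3 x).const_mul (2 / 3 : ℝ)).sub
      ((hasDerivAt_pow 2 x).const_mul (3 / 2 : ℝ))).add (hasDerivAt_id x))
    refine this.congr_deriv ?_
    simp only [Nat.reduceSub, pow_one, Nat.cast_ofNat, foldH]
    ring
  rw [intervalIntegral.integral_eq_sub_of_hasDerivAt h ((by unfold foldH; fun_prop : Continuous fun x : ℝ =>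
    (0 : ℝ) - foldH x).intervalIntegrable _ _)]
  norm_num

/-- Auxiliary: `continuous_foldH`. [folklore] -/
theorem continuous_foldH : Continuous foldH := by unfold foldH; fun_prop

/-- `bandTwo = {b ∈ (0,1), b² − b < w < 0}` (the first disjunct is empty on `(0,1)`). [folklore] -/
theorem bandTwo_eq : bandTwo = {q : Fin 2 → ℝ | q 0 ∈ Ioo (0 : ℝ) 1 ∧
    (fun x : ℝ => x ^ 2 - x) (q 0) < q 1 ∧ q 1 < (fun _ : ℝ => (0 : ℝ)) (q 0)} := by
  ext q
  simp only [bandTwo, mem_setOf_eq, foldB_left, foldB_right, mem_Ioo]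
  constructor
  · rintro ⟨hq, h | h⟩
    · exfalso; nlinarith [h.1, h.2, hq.1, hq.2]
    · exact ⟨hq, h.1, h.2⟩
  · rintro ⟨hq, h1, h2⟩
    exact ⟨hq, Or.inr ⟨h1, h2⟩⟩

/-- Auxiliary: `volume_bandTwo`. [folklore] -/
theorem volume_bandTwo : volume bandTwo = ENNReal.ofReal (1 / 6) := by
  rw [bandTwo_eq, volume_fibred (f := fun x : ℝ => x ^ 2 - x) (g := fun _ : ℝ => (0 : ℝ)) (u := 0) (v := 1)
    (by fun_prop) (by fun_prop) (fun x hx => by nlinarith [hx.1, hx.2]),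
    setIntegral_Ioo_eq_intervalIntegral zero_le_one, integral_bandTwo]

/-- `bandOne` splits along `a = ½` into the positive sheet and the folded sheet. [folklore] -/
theorem bandOne_eq : bandOne =
    {q : Fin 2 → ℝ | q 0 ∈ Ioo (1 / 2 : ℝ) 1 ∧ (fun _ : ℝ => (0 : ℝ)) (q 0) < q 1 ∧ q 1 < foldH (q 0)} ∪
    {q : Fin 2 → ℝ | q 0 ∈ Ioo (0 : ℝ) (1 / 2) ∧ foldH (q 0) < q 1 ∧ q 1 < (fun _ : ℝ => (0 : ℝ)) (q 0)} := by
  ext q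
  simp only [bandOne, mem_setOf_eq, foldA_bottom, foldA_top, mem_Ioo, mem_union, foldH]
  constructor
  · rintro ⟨hq, h | h⟩
    · left
      refine ⟨⟨?_, hq.2⟩, h.1, h.2⟩
      nlinarith [h.1, h.2, hq.1, hq.2]
    · right
      refine ⟨⟨hq.1, ?_⟩, h.1, h.2⟩
      nlinarith [h.1, h.2, hq.1, hq.2]
  · rintro (⟨hq, h1, h2⟩ | ⟨hq, h1, h2⟩)
    · exact ⟨⟨by linarith [hq.1], hq.2⟩, Or.inl ⟨h1, h2⟩⟩
    · exact ⟨⟨hq.1, by linarith [hq.2]⟩, Or.inr ⟨h1, h2⟩⟩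

/-- Auxiliary: `volume_bandOne`. [folklore] -/
theorem volume_bandOne : volume bandOne = ENNReal.ofReal (1 / 4) := by
  have hpos : ∀ x ∈ Ioo (1 / 2 : ℝ) 1, (fun _ : ℝ => (0 : ℝ)) x ≤ foldH x := fun x hx => by
    simp only [foldH]; nlinarith [hx.1, hx.2]
  have hneg : ∀ x ∈ Ioo (0 : ℝ) (1 / 2), foldH x ≤ (fun _ : ℝ => (0 : ℝ)) x := fun x hx => by
    simp only [foldH]; nlinarith [hx.1, hx.2]
  rw [bandOne_eq, measure_union]
  · rw [volume_fibred (f := fun _ : ℝ => (0 : ℝ)) (g := foldH) (u := 1 / 2) (v := 1) (by fun_prop)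
        continuous_foldH hpos,
      volume_fibred (f := foldH) (g := fun _ : ℝ => (0 : ℝ)) (u := 0) (v := 1 / 2) continuous_foldH
        (by fun_prop) hneg,
      setIntegral_Ioo_eq_intervalIntegral (by norm_num), setIntegral_Ioo_eq_intervalIntegral (by norm_num),
      integral_bandOne_pos, integral_bandOne_neg, ← ENNReal.ofReal_add (by norm_num) (by norm_num)]
    norm_num
  · rw [Set.disjoint_left]
    rintro q ⟨hq, -, -⟩ ⟨hq', -, -⟩
    linarith [hq.1, hq'.2]
  · -- measurability of the folded sheet
    rw [← preimage_regionBetween foldH (fun _ : ℝ => (0 : ℝ)) (Ioo (0 : ℝ) (1 / 2))]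
    exact (measurableSet_regionBetween continuous_foldH.measurable measurable_const
      measurableSet_Ioo).preimage MeasurableEquiv.finTwoArrow.measurable

/-- Auxiliary: `isSemialgebraic_bandOne`. [folklore] -/
theorem isSemialgebraic_bandOne : IsSemialgebraic ℚ bandOne := by
  -- bandOne = {0 < a < 1} ∩ ({0 < y ∧ y < h} ∪ {h < y ∧ y < 0}), all polynomial inequalities
  let P : MvPolynomial (Fin 2) ℚ := (C 2 * X 0 - C 1) * (C 1 - X 0)
  have hP : ∀ q : Fin 2 → ℝ, aeval q P = foldH (q 0) := by intro q; simp [P, foldH]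
  have h := ((isSemialgebraic_setOf_eval_lt (k := ℚ) (R := ℝ) (ι := Fin 2) (C 0) (X 0)).inter
    (isSemialgebraic_setOf_eval_lt (k := ℚ) (R := ℝ) (ι := Fin 2) (X 0) (C 1))).inter
    (((isSemialgebraic_setOf_eval_lt (k := ℚ) (R := ℝ) (ι := Fin 2) (C 0) (X 1)).inter
      (isSemialgebraic_setOf_eval_lt (k := ℚ) (R := ℝ) (ι := Fin 2) (X 1) P)).union
     ((isSemialgebraic_setOf_eval_lt (k := ℚ) (R := ℝ) (ι := Fin 2) P (X 1)).inter
      (isSemialgebraic_setOf_eval_lt (k := ℚ) (R := ℝ) (ι := Fin 2) (X 1) (C 0))))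
  have key : ∀ S' : Set (Fin 2 → ℝ), IsSemialgebraic ℚ S' → bandOne = S' → IsSemialgebraic ℚ bandOne := by
    rintro S' hS rfl; exact hS
  refine key _ h ?_
  ext q
  simp only [bandOne, mem_setOf_eq, foldA_bottom, foldA_top, mem_Ioo, mem_inter_iff, mem_union, hP,
    map_zero, map_one, aeval_X]

/-- Auxiliary: `isSemialgebraic_bandTwo`. [folklore] -/
theorem isSemialgebraic_bandTwo : IsSemialgebraic ℚ bandTwo := by
  let P : MvPolynomial (Fin 2) ℚ := X 0 ^ 2 - X 0
  have hP : ∀ q : Fin 2 → ℝ, aeval q P = q 0 ^ 2 - q 0 := by intro q; simp [P]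
  have h := ((isSemialgebraic_setOf_eval_lt (k := ℚ) (R := ℝ) (ι := Fin 2) (C 0) (X 0)).inter
    (isSemialgebraic_setOf_eval_lt (k := ℚ) (R := ℝ) (ι := Fin 2) (X 0) (C 1))).inter
    (((isSemialgebraic_setOf_eval_lt (k := ℚ) (R := ℝ) (ι := Fin 2) (C 0) (X 1)).inter
      (isSemialgebraic_setOf_eval_lt (k := ℚ) (R := ℝ) (ι := Fin 2) (X 1) P)).union
     ((isSemialgebraic_setOf_eval_lt (k := ℚ) (R := ℝ) (ι := Fin 2) P (X 1)).inter
      (isSemialgebraic_setOf_eval_lt (k := ℚ) (R := ℝ) (ι := Fin 2) (X 1) (C 0))))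
  have key : ∀ S' : Set (Fin 2 → ℝ), IsSemialgebraic ℚ S' → bandTwo = S' → IsSemialgebraic ℚ bandTwo := by
    rintro S' hS rfl; exact hS
  refine key _ h ?_
  ext q
  simp only [bandTwo, mem_setOf_eq, foldB_left, foldB_right, mem_Ioo, mem_inter_iff, mem_union, hP,
    map_zero, map_one, aeval_X]

/-- Auxiliary: `volume_bandOne_lt_top`. [folklore] -/
theorem volume_bandOne_lt_top : volume bandOne < ⊤ := by
  rw [volume_bandOne]; exact ENNReal.ofReal_lt_top
/-- Auxiliary: `volume_bandTwo_lt_top`. [folklore] -/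
theorem volume_bandTwo_lt_top : volume bandTwo < ⊤ := by
  rw [volume_bandTwo]; exact ENNReal.ofReal_lt_top

/-- `[Ω₁, 1]`. [folklore] -/
def bandOneRep : KZ.IntegralRep 2 where
  domain := bandOne
  integrand := fun _ => 1
  isSemialgebraic_domain := isSemialgebraic_bandOne
  isSemialgebraicFunOn_integrand := isSemialgebraicFunOn_one isSemialgebraic_bandOne
  integrableOn := integrableOn_const volume_bandOne_lt_top.ne

/-- `[Ω₂, 1]`. [folklore] -/
def bandTwoRep : KZ.IntegralRep 2 where
  domain := bandTwo
  integrand := fun _ => 1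
  isSemialgebraic_domain := isSemialgebraic_bandTwo
  isSemialgebraicFunOn_integrand := isSemialgebraicFunOn_one isSemialgebraic_bandTwo
  integrableOn := integrableOn_const volume_bandTwo_lt_top.ne

/-- Auxiliary: `value_bandOneRep`. [folklore] -/
theorem value_bandOneRep : bandOneRep.value = 1 / 4 := by
  rw [value_of_integrand_one _ rfl, show bandOneRep.domain = bandOne from rfl, volume_bandOne,
    ENNReal.toReal_ofReal (by norm_num)]

/-- Auxiliary: `value_bandTwoRep`. [folklore] -/
theorem value_bandTwoRep : bandTwoRep.value = 1 / 6 := by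
  rw [value_of_integrand_one _ rfl, show bandTwoRep.domain = bandTwo from rfl, volume_bandTwo,
    ENNReal.toReal_ofReal (by norm_num)]

/-- NAIVE GREEN BANDS (a refuted strengthening of the plan's Green step, stated here only to be
negated): for Green data as typed in the crux, the band of vertical traces and the band of
horizontal traces are KZ-equivalent — the weakest conceivable form of "Green ↦ transport of the
two bands" without subdivision by the sign of the twist. -/
def NaiveGreenBands : Prop :=
  ∀ (A B S : (Fin 2 → ℝ) → ℝ), IsSemialgebraicFunOn ℚ triangle A → IsSemialgebraicFunOn ℚ triangle B →
    ContinuousOn A triangle → ContinuousOn B triangle →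
    (∀ p : Fin 2 → ℝ, 0 < p 0 → 0 < p 1 → p 0 + p 1 < 1 →
      HasFDerivAt S (A p • ContinuousLinearMap.proj (R := ℝ) (φ := fun _ : Fin 2 => ℝ) 0 +
        B p • ContinuousLinearMap.proj (R := ℝ) (φ := fun _ : Fin 2 => ℝ) 1) p) →
    ∀ r r' : KZ.IntegralRep 2,
      r.domain = {q | q 0 ∈ Ioo (0 : ℝ) 1 ∧ ((A ![q 0, 0] < q 1 ∧ q 1 < A ![q 0, 1 - q 0]) ∨
        (A ![q 0, 1 - q 0] < q 1 ∧ q 1 < A ![q 0, 0]))} →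
      r'.domain = {q | q 0 ∈ Ioo (0 : ℝ) 1 ∧ ((B ![0, q 0] < q 1 ∧ q 1 < B ![1 - q 0, q 0]) ∨
        (B ![1 - q 0, q 0] < q 1 ∧ q 1 < B ![0, q 0]))} →
      (∀ p ∈ r.domain, r.integrand p = 1) → (∀ p ∈ r'.domain, r'.integrand p = 1) →
      KZ.Equivalent r r'

/-- THE FOLD IS REAL: `NaiveGreenBands` is false — for `S = (a² − a)b` the two bands have areas
`1/4 ≠ 1/6` (soundness of the whole KZ calculus, `KZ.Equivalent.value_eq_holds`). A fortiori no
planar chain and no single rule-2 instance relates them. [folklore] -/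
theorem not_naiveGreenBands : ¬ NaiveGreenBands := by
  intro h
  have hEq := h foldA foldB foldS isSemialgebraicFunOn_foldA isSemialgebraicFunOn_foldB
    continuous_foldA.continuousOn continuous_foldB.continuousOn (fun p _ _ _ => hasFDerivAt_foldS p)
    bandOneRep bandTwoRep rfl rfl (fun _ _ => rfl) (fun _ _ => rfl)
  have hv := KZ.Equivalent.value_eq_holds hEq
  rw [value_bandOneRep, value_bandTwoRep] at hv
  norm_num at hv

/-- … while the SIGNED identity behind the Green generator holds for the same datum:
`∫₀¹ A(t,0) dt + ∫₀¹ (B − A)(1−t,t) dt − ∫₀¹ B(0,t) dt = 0 + (1/6 − (−1/6)) … = 0`, here in the form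
`∫₀¹ h = −1/6 = −∫₀¹ (b − b²)`: the folded sheet must be counted negatively. [folklore] -/
theorem fold_signed_identity :
    ∫ x in (0 : ℝ)..1, foldH x = -(1 / 6) ∧ ∫ x in (0 : ℝ)..1, (x ^ 2 - x) = -(1 / 6) := by
  constructor
  · have h : ∀ x ∈ uIcc (0 : ℝ) 1,
        HasDerivAt (fun x : ℝ => -(2 / 3) * x ^ 3 + (3 / 2) * x ^ 2 - x) (foldH x) x := by
      intro x _
      have := ((((hasDerivAt_pow 3 x).const_mul (-(2 / 3) : ℝ)).add
        ((hasDerivAt_pow 2 x).const_mul (3 / 2 : ℝ))).sub (hasDerivAt_id x))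
      refine this.congr_deriv ?_
      simp only [Nat.reduceSub, pow_one, Nat.cast_ofNat, foldH]
      ring
    rw [intervalIntegral.integral_eq_sub_of_hasDerivAt h (continuous_foldH.intervalIntegrable _ _)]
    norm_num
  · norm_num [integral_pow, integral_id, intervalIntegral.integral_sub]

end Summit.KontsevichZagierPeriods.SymplecticScissors.PlanarCompilerNegative
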